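import Mathlib
import Summits.AtomisticToContinuum.Crystallization.Theses.ChartedPlanarOrder
import Summits.AtomisticToContinuum.Crystallization.Theses.MatrixSaturationDichotomy
import Summits.AtomisticToContinuum.Crystallization.Theorems.PlanarOrderLadderExactPlanarFromUniform
import Summits.AtomisticToContinuum.Crystallization.Theorems.HullPeriodRankPeriodicOfThreePeriods
import Literature.MathematicalPhysics.StatisticalMechanics.LennardJonesClusters
import Literature.MathematicalPhysics.StatisticalMechanics.LocalMatchingCompactness
import Summits.AtomisticToContinuum.Crystallization.Theorems.HullMinimalityLayeredWindowsGoodRegionDense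
import Summits.AtomisticToContinuum.Crystallization.Theorems.HullMinimalityLayeredWindowsPatternCovering

/-!
# decomp-a2c · lens-3 · GEN 7 — the PER-SEQUENCE K-factorisation (critic lineage remark lens-3 #2)

Cell `decomp-a2c`, node N_C.A.1.M².CPO (`ChartedPlanarOrder`, lens-3 g6) vs. node N_C.A.1
(`MatrixSaturationDichotomy`, lens-2 g2).  The g6 node claimed «lens-2's K (= `CleanBallCase`,
stmt-AtomisticToContinuum-26136) factors as CB (= `CleanBallPlanarOrder`, stmt-32136) + the lens-3 rungs»,
but certified it only through the FULL conjunction (`lens2_cleanBallCase_of_pieces` consumed GB and SAT too).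
This file certifies the per-sequence factorisation WITHOUT `GenericBulkPlanarOrder`, WITHOUT
`SaturatedPlanarOrder` and WITHOUT the `DeloneHullPoint` hypothesis:

* `deloneHullPoint_of_cleanBalls` — **new, sorry-free**: a sequence of Lennard-Jones ground states with
  all-two-shell-good balls of every radius (frequently in `N`) has a DELONE hull point (uniformly separated,
  relatively dense set two-way matched by translates of the configurations on every ball, frequently in `N`).
  Ingredients (all landed): the uniform minimal distance of LJ ground states
  (`LennardJonesMinimalDistance_holds`), sequential compactness of uniformly discrete point sets in the local
  matching topology (`exists_subseq_forall_eventually_ballMatch`, Baake–Grimm 2013 Rem. 5.6), and relative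
  denseness of all-good regions (`LayeredWindowsLocal.stub_goodRegionDense` with the covering constant `2/11` of
  `LayeredWindowsLocal.stub_patternCovering`).  In particular the fourth hypothesis of `CleanBallPlanarOrder`
  (a Delone hull point of `x`) is REDUNDANT given its third (clean balls): `cleanBallPlanarOrder_dhpFree_iff`.
* `cleanBallCase_of_CB_and_rungs : CleanBallPlanarOrder → PlanarCoherence → PlanarLockIn →
  ThirdPeriodFromSecond → MatrixSaturationDichotomy.CleanBallCase` — the critic's exact target, by the chain
  CB ↦ M²-form ↦ (PlanarCoherence) coherent pairs ↦ (PlanarLockIn) uniformly fine pairs ↦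
  (`exactPlanarFromUniform_proof`, item 29691 PROVED) two exact periods ↦ (ThirdPeriodFromSecond) three ↦
  (`periodicOfThreePeriods_proof`, item 24147 PROVED) a `PeriodicConfiguration 3` whose point set is the hull
  point, i.e. periodic windows for `x`.

No new definitions; 0 sorry. [folklore]
-/

noncomputable section

namespace Summit.AtomisticToContinuum.Crystallization.Theorems.ChartedPlanarOrderKFactorisation

/-! ## The new content -/

open Filter Topology Metric
open Literature.MathematicalPhysics.StatisticalMechanics Literature.Geometry.DiscreteGeometry
open Summit.AtomisticToContinuum.Crystallization.Theses

local notation "E3" => EuclideanSpace ℝ (Fin 3)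


/-- **Clean balls give a Delone hull point.**  If `x N` are Lennard-Jones ground states and for every
radius `ρ`, frequently in `N`, some particle's `ρ`-ball is all two-shell good (`IsTwoShellGood (1/20) (47/50) 1`),
then some uniformly separated, relatively dense `X ⊆ ℝ³` is two-way `ε`-matched on every ball `‖·‖ ≤ R` by a
translate of `x N`, frequently in `N`. [folklore] -/
theorem deloneHullPoint_of_cleanBalls (x : (N : ℕ) → (Fin N → E3))
    (hx : ∀ N, IsGroundState lennardJones (x N))
    (hclean : ∀ ρ : ℝ, ∃ᶠ N in atTop, ∃ i : Fin N, ∀ j : Fin N,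
      dist (x N j) (x N i) ≤ ρ → IsTwoShellGood (1 / 20) (47 / 50) 1 (x N) j) :
    ∃ X : Set E3, ((∃ δ : ℝ, 0 < δ ∧ ∀ p ∈ X, ∀ q ∈ X, p ≠ q → δ ≤ dist p q) ∧
      (∃ r : ℝ, ∀ c : E3, ∃ p ∈ X, dist p c ≤ r)) ∧
      (∀ R ε : ℝ, 0 < ε → ∃ᶠ N in atTop, ∃ t : E3,
        (∀ p ∈ X, ‖p‖ ≤ R → ∃ i : Fin N, dist (x N i + t) p ≤ ε) ∧
        (∀ i : Fin N, ‖x N i + t‖ ≤ R → ∃ p ∈ X, dist (x N i + t) p ≤ ε)) := by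
  -- uniform separation of ground states
  obtain ⟨δ, hδ, hsep⟩ := LennardJonesMinimalDistance_holds
  -- relative denseness of all-good regions
  obtain ⟨r₀, hr₀, hdense⟩ :=
    LayeredWindowsLocal.stub_goodRegionDense (2 / 11) (by norm_num) LayeredWindowsLocal.stub_patternCovering
  -- diagonal choice: for every `n`, an index `φ n` (strictly increasing) and a centre with an all-good `n`-ball
  obtain ⟨φ, hφ, hgood⟩ := extraction_forall_of_frequently (fun n : ℕ => hclean (n : ℝ))
  choose c hc using hgood
  -- the recentred point sets
  set Ys : ℕ → Set E3 := fun n => Set.range fun j : Fin (φ n) => x (φ n) j - x (φ n) (c n) with hYs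
  have hYsep : ∀ n, ∀ p ∈ Ys n, ∀ q ∈ Ys n, p ≠ q → δ ≤ dist p q := by
    intro n p hp q hq hpq
    obtain ⟨j, rfl⟩ := hp
    obtain ⟨j', rfl⟩ := hq
    have hjj' : j ≠ j' := fun h => hpq (by rw [h])
    have := hsep (φ n) (x (φ n)) (hx (φ n)) j j' hjj'
    simpa [dist_eq_norm] using this
  -- compactness in the local matching topology
  obtain ⟨ψ, Y, hψ, hYsep', hmatch⟩ := exists_subseq_forall_eventually_ballMatch hδ Ys hYsep
  refine ⟨Y, ⟨⟨δ, hδ, hYsep'⟩, ⟨r₀ + 1, fun c₀ => ?_⟩⟩, fun R ε hε => ?_⟩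
  · -- relative denseness: follow `c₀` back to a late approximant with a large all-good ball
    obtain ⟨n₀, hn₀⟩ := exists_nat_ge (2 * (‖c₀‖ + r₀))
    have hev := (hmatch (‖c₀‖ + r₀) 1 one_pos).and (hψ.tendsto_atTop.eventually (eventually_ge_atTop n₀))
    obtain ⟨k, hk, hkn⟩ := hev.exists
    set n := ψ k with hn
    -- the point `c₀` in the original coordinates of the `n`-th approximant
    have hy : dist (c₀ + x (φ n) (c n)) (x (φ n) (c n)) + r₀ ≤ (n : ℝ) / 2 := by
      have h1 : dist (c₀ + x (φ n) (c n)) (x (φ n) (c n)) = ‖c₀‖ := by simp [dist_eq_norm]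
      have h2 : (n₀ : ℝ) ≤ n := by exact_mod_cast hkn
      rw [h1]; linarith
    obtain ⟨j, hj⟩ := hdense (φ n) (x (φ n)) (c n) n (hc n) (c₀ + x (φ n) (c n)) hy
    have hjY : x (φ n) j - x (φ n) (c n) ∈ Ys n := ⟨j, rfl⟩
    have hjc : dist (x (φ n) j - x (φ n) (c n)) c₀ < r₀ := by
      have : dist (x (φ n) j - x (φ n) (c n)) c₀ = dist (x (φ n) j) (c₀ + x (φ n) (c n)) := by
        simp only [dist_eq_norm]; congr 1; abel
      rw [this]; exact hj
    have hjR : dist (x (φ n) j - x (φ n) (c n)) 0 ≤ ‖c₀‖ + r₀ := by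
      rw [dist_zero_right]
      have htri : ‖x (φ n) j - x (φ n) (c n)‖ ≤ ‖c₀‖ + ‖x (φ n) j - x (φ n) (c n) - c₀‖ :=
        norm_le_norm_add_norm_sub' (x (φ n) j - x (φ n) (c n)) c₀
      rw [dist_eq_norm] at hjc
      linarith
    obtain ⟨s, hs, hds⟩ := hk.2 _ hjY hjR
    refine ⟨s, hs, ?_⟩
    calc dist s c₀ ≤ dist (x (φ n) j - x (φ n) (c n)) s + dist (x (φ n) j - x (φ n) (c n)) c₀ :=
          dist_triangle_left _ _ _
      _ ≤ 1 + r₀ := by linarith [hds, hjc.le]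
      _ = r₀ + 1 := by ring
  · -- hull property: eventually along `φ ∘ ψ`, hence frequently in `N`
    have hT : Tendsto (fun k => φ (ψ k)) atTop atTop := hφ.tendsto_atTop.comp hψ.tendsto_atTop
    refine hT.frequently ((hmatch R ε hε).mono fun k hk => ?_).frequently
    refine ⟨-x (φ (ψ k)) (c (ψ k)), fun p hp hpR => ?_, fun i hiR => ?_⟩
    · obtain ⟨a, ⟨j, rfl⟩, hja⟩ := hk.1 p hp (by rwa [dist_zero_right])
      exact ⟨j, by simpa [sub_eq_add_neg] using hja⟩
    · have hmem : x (φ (ψ k)) i - x (φ (ψ k)) (c (ψ k)) ∈ Ys (ψ k) := ⟨i, rfl⟩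
      obtain ⟨s, hs, hds⟩ := hk.2 _ hmem (by rw [dist_zero_right]; simpa [sub_eq_add_neg] using hiR)
      exact ⟨s, hs, by simpa [sub_eq_add_neg] using hds⟩

/-- The `DeloneHullPoint` hypothesis of `CleanBallPlanarOrder` is redundant: the crux is equivalent to its
DHP-free form. [folklore] -/
theorem cleanBallPlanarOrder_dhpFree_iff :
    ChartedPlanarOrder.CleanBallPlanarOrder ↔
    ∀ x : (N : ℕ) → (Fin N → E3), (∀ N, IsGroundState lennardJones (x N)) →
      (∃ R₁ : ℝ, ∀ᶠ N in Filter.atTop, ∀ i : Fin N, ∃ j : Fin N, dist (x N j) (x N i) ≤ R₁ ∧ (let d : ℝ := sInf ((fun z => dist z (x N j)) '' (Set.range (x N) \ {(x N j)})); let T : Set (EuclideanSpace ℝ (Fin 3)) := {z : EuclideanSpace ℝ (Fin 3) | z ∈ Set.range (x N) ∧ z ≠ (x N j) ∧ dist z (x N j) < 13 / 10 * d}; ∃ A : EuclideanSpace ℝ (Fin 3) →ₗᵢ[ℝ] EuclideanSpace ℝ (Fin 3), (∃ e : ↥T ≃ ↥Literature.Geometry.DiscreteGeometry.fccKissingPattern,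 ∀ t : ↥T, dist (d⁻¹ • ((t : EuclideanSpace ℝ (Fin 3)) - (x N j))) (A ((e t : ↥Literature.Geometry.DiscreteGeometry.fccKissingPattern) : EuclideanSpace ℝ (Fin 3))) ≤ 1 / 20) ∨ (∃ e : ↥T ≃ ↥Literature.Geometry.DiscreteGeometry.hcpKissingPattern, ∀ t : ↥T, dist (d⁻¹ • ((t : EuclideanSpace ℝ (Fin 3)) - (x N j))) (A ((e t : ↥Literature.Geometry.DiscreteGeometry.hcpKissingPattern) : EuclideanSpace ℝ (Fin 3))) ≤ 1 / 20))) →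
      (∀ ρ : ℝ, ∃ᶠ N in Filter.atTop, ∃ i : Fin N, ∀ j : Fin N, dist (x N j) (x N i) ≤ ρ → IsTwoShellGood (1 / 20) (47 / 50) 1 (x N) j) →
      ∃ X : Set (EuclideanSpace ℝ (Fin 3)), ∃ δ r b : ℝ, 0 < δ ∧ (∀ p ∈ X, ∀ q ∈ X, p ≠ q → δ ≤ dist p q) ∧ (∀ c : EuclideanSpace ℝ (Fin 3), ∃ p ∈ X, dist p c ≤ r) ∧ (∀ R ε : ℝ, 0 < ε → ∃ᶠ N in Filter.atTop, ∃ t : EuclideanSpace ℝ (Fin 3), (∀ p ∈ X, ‖p‖ ≤ R → ∃ i : Fin N, dist (x N i + t) p ≤ ε) ∧ (∀ i : Fin N, ‖x N i + t‖ ≤ R → ∃ p ∈ X, dist (x N i + t) p ≤ ε)) ∧ ∀ c : EuclideanSpace ℝ (Fin 3), ∃ t₁ t₂ : EuclideanSpace ℝ (Fin 3), δ ≤ ‖t₁‖ ∧ ‖t₁‖ ≤ b ∧ ‖t₂‖ ≤ b ∧ (∀ s : ℝ, δ ≤ ‖t₂ - s • t₁‖) ∧ ∀ p ∈ X, dist p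 c ≤ 4 * b → (∃ q ∈ X, dist (p + t₁) q ≤ δ / 4) ∧ (∃ q ∈ X, dist (p - t₁) q ≤ δ / 4) ∧ (∃ q ∈ X, dist (p + t₂) q ≤ δ / 4) ∧ (∃ q ∈ X, dist (p - t₂) q ≤ δ / 4) := by
  constructor
  · intro h x hx hchart hclean
    exact h x hx hchart hclean (deloneHullPoint_of_cleanBalls x hx hclean)
  · intro h x hx hchart hclean _
    exact h x hx hchart hclean

/-- **The per-sequence K-factorisation** (critic lineage remark lens-3 #2): lens-2's `CleanBallCase` (K,
stmt-26136) follows from lens-3's `CleanBallPlanarOrder` (CB, stmt-32136) and the lens-3 rungs `PlanarCoherence`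
(29689), `PlanarLockIn` (29690), `ThirdPeriodFromSecond` (24146) — through the PROVED `ExactPlanarFromUniform`
(29691) and `PeriodicOfThreePeriods` (24147) — with NO use of `GenericBulkPlanarOrder`, `SaturatedPlanarOrder`
or `DeloneHullPoint`. [folklore] -/
theorem cleanBallCase_of_CB_and_rungs :
    ChartedPlanarOrder.CleanBallPlanarOrder → ChartedPlanarOrder.PlanarCoherence →
      ChartedPlanarOrder.PlanarLockIn → ChartedPlanarOrder.ThirdPeriodFromSecond →
        MatrixSaturationDichotomy.CleanBallCase := by
  intro hCB hPC hPL hTP x hx hchart hclean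
  obtain ⟨X, hD, hP, hH⟩ := hTP x hx
    (PlanarOrderLadderExactPlanarFromUniform.exactPlanarFromUniform_proof x
      (hPL x hx (hPC x hx (hCB x hx hchart hclean (deloneHullPoint_of_cleanBalls x hx hclean)))))
  obtain ⟨P, hPX⟩ := HullPeriodRankPeriodicOfThreePeriods.periodicOfThreePeriods_proof X hD hP
  refine ⟨P, ?_⟩
  rw [hPX]
  exact hH

/-- The same with `DeloneHullPoint` kept as a (global) hypothesis — the one-line version, for the record. -/
theorem cleanBallCase_of_CB_and_rungs' :
    ChartedPlanarOrder.DeloneHullPoint → ChartedPlanarOrder.CleanBallPlanarOrder → ChartedPlanarOrder.PlanarCoherence →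
      ChartedPlanarOrder.PlanarLockIn → ChartedPlanarOrder.ThirdPeriodFromSecond →
        MatrixSaturationDichotomy.CleanBallCase := by
  intro _ hCB hPC hPL hTP
  exact cleanBallCase_of_CB_and_rungs hCB hPC hPL hTP

end Summit.AtomisticToContinuum.Crystallization.Theorems.ChartedPlanarOrderKFactorisation

end
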